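import Summits.QuantumFields.YangMills.Theorems.FlatTubeReductionRecordProfileNumbers
import HarnessLib

/-!
# Gaussian numbers of the REWEIGHTED record profile

Support file for the crux `NearFlatRatioLaw` (line `ratepack_v2`, stub `stub_hODpot_A`, step (R3c) of
`Cruxes/NearFlatRatioLaw/Lines/ratepack-v7-moments-g18.md` §13).

`…FibreFactorReferenceMass.fibre_factor_le_reference_mass` (with `Ω = recordProfile L β`, which is by definition the record profile of
`…CoreDefectRecordOrbitMoments`) asks for the profile numbers of the reweighted record profile: `∫ recordProfile·(1+β‖x̂‖²)^m·(√β‖x̂‖)^p dπ`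
bounded by a constant times the core mass `∫_{coreBox} recordProfile dπ`.  Exactly as in `…RecordProfileNumbers` (transverse master bound
`orthoTransverse_gauss_moment_le` with the weight `(balLevel + 1)^{m+p}`, `recordProfile ≤ e^{-c·balLevel}`, and the core floor
`recordProfile_core_floor`): `recordProfile_reweighted_moment_le` (against the sub-level volume) and `recordProfile_reweighted_moment_le_core`
(against the core mass, and against the reweighted core mass).  No logarithm: both sides are Gaussian numbers at scale `β^{-1/2}`.
-/

noncomputable section

open MeasureTheory Filter Topology Real Set
open scoped BigOperators
open Literature.MathematicalPhysics.QuantumFieldTheory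
open Literature.MathematicalPhysics.QuantumLattice

namespace Summit.QuantumFields.YangMills.Theorems.FemtoTransferGap.RateTube

open Summit.QuantumFields.YangMills.Theorems.FemtoTransferGap
open Summit.QuantumFields.YangMills.Theorems.FemtoTransferGap.TwoLattice
open Summit.QuantumFields.YangMills.Theorems.FemtoTransferGap.TwoLattice.ConstTube
open Summit.QuantumFields.YangMills.Theorems.FemtoTransferGap.TwoLattice.Toron
open Summit.QuantumFields.YangMills.Theorems.FemtoTransferGap.TwoLattice.Avg

variable (L : ℕ) [NeZero L]

/-- ★★ **Reweighted record profile numbers against the sub-level volume**: for `2 ≤ L` there are `K > 0`, `β₁ ≥ 1` with, for all `β ≥ β₁`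
and all `m p : ℕ`, `∫ recordProfile·(1+β‖x̂‖²)^m(√β‖x̂‖)^p dπ ≤ K·(5e·2^{m+p}·4^d·(m+p)!·d!)·c^{-(m+p+d)}·vol_β`,
`c = min 1 ((2 − 2cos(2π/L))/2)`, `d` the transverse dimension, `vol_β` the volume of the unit sub-level set of `balLevel β`. [folklore] -/
theorem recordProfile_reweighted_moment_le (hL : 2 ≤ L) :
    ∃ K β₁ : ℝ, 0 < K ∧ 1 ≤ β₁ ∧ ∀ β : ℝ, β₁ ≤ β → ∀ m p : ℕ,
      ∫ v, recordProfile L β (linkEmbed L v) * (1 + β * ‖linkEmbed L v‖ ^ 2) ^ m * (Real.sqrt β * ‖linkEmbed L v‖) ^ p ∂orthoTransverse L ≤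
        K * 1 * (5 * Real.exp 1 * 2 ^ (m + p) * 4 ^ Module.finrank ℝ ({e : Edge 3 L // ¬e.1 = 0} → Fin 3 → ℝ) * (m + p).factorial *
              (Module.finrank ℝ ({e : Edge 3 L // ¬e.1 = 0} → Fin 3 → ℝ)).factorial) *
            ((min 1 ((2 - 2 * Real.cos (2 * Real.pi / L)) / 2)) ^ ((m + p) + Module.finrank ℝ ({e : Edge 3 L // ¬e.1 = 0} → Fin 3 → ℝ)))⁻¹ *
          (volume {w : {e : Edge 3 L // ¬e.1 = 0} → Fin 3 → ℝ | balLevel L β (balExt L w) ≤ 1}).toReal := by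
  have hle := measurable_linkEmbed L
  obtain ⟨hΩm, hΩ01, -, -⟩ := recordProfile_fields L
  obtain ⟨K, β₁, hK, hβ₁1, hmom⟩ := orthoTransverse_gauss_moment_le L
  have hc0 : 0 < min 1 ((2 - 2 * Real.cos (2 * Real.pi / L)) / 2) := lt_min one_pos (half_pos (gap_pos (L := L) hL))
  have hc1 : min 1 ((2 - 2 * Real.cos (2 * Real.pi / L)) / 2) ≤ 1 := min_le_left _ _
  refine ⟨K, β₁, hK, hβ₁1, fun β hβ m p => ?_⟩
  have hβ1 : 1 ≤ β := hβ₁1.trans hβ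
  refine hmom β hβ _ hc0 hc1 (m + p) 1 zero_le_one _ (((hΩm β).comp hle).mul ((measurable_const.add ((hle.norm.pow_const 2).const_mul β)).pow_const m) |>.mul
    ((measurable_const.mul hle.norm).pow_const p)) (fun v => ?_) (fun v => ?_) (fun v hv => ?_)
  · exact mul_nonneg (mul_nonneg (hΩ01 β _).1 (by positivity)) (by positivity)
  · have h1 := recordProfile_le_exp_neg L hL hβ1 v
    have h2 := one_add_mul_norm_sq_pow_le L hβ1 v m
    have h3 := sqrt_mul_norm_pow_le_balLevel_add_one L hβ1 v p
    have hN := balLevel_nonneg L (by linarith : (0 : ℝ) ≤ β) v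
    calc recordProfile L β (linkEmbed L v) * (1 + β * ‖linkEmbed L v‖ ^ 2) ^ m * (Real.sqrt β * ‖linkEmbed L v‖) ^ p
        ≤ Real.exp (-(min 1 ((2 - 2 * Real.cos (2 * Real.pi / L)) / 2) * balLevel L β v)) * (balLevel L β v + 1) ^ m * (balLevel L β v + 1) ^ p :=
          mul_le_mul (mul_le_mul h1 h2 (by positivity) (Real.exp_nonneg _)) h3 (by positivity) (by positivity)
      _ = 1 * (Real.exp (-(min 1 ((2 - 2 * Real.cos (2 * Real.pi / L)) / 2) * balLevel L β v)) * (balLevel L β v + 1) ^ (m + p)) := by rw [pow_add]; ring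
  · have hne : recordProfile L β (linkEmbed L v) ≠ 0 := fun h => hv (by rw [h, zero_mul, zero_mul])
    exact (recordProfile_support L hne).2.2

/-- ★★★ **Reweighted record profile numbers against the (reweighted) core mass**: for `2 ≤ L` there are `A : ℕ → ℝ` (`≥ 0`) and `β₃` with,
for all `β ≥ β₃`, all `m p K' : ℕ`,
`∫ recordProfile·(1+β‖x̂‖²)^m(√β‖x̂‖)^p dπ ≤ A(m+p)·∫_{coreBox} recordProfile dπ ≤ A(m+p)·∫_{coreBox} recordProfile·(1+β‖x̂‖²)^{K'} dπ`. [folklore] -/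
theorem recordProfile_reweighted_moment_le_core (hL : 2 ≤ L) :
    ∃ (A : ℕ → ℝ) (β₃ : ℝ), (∀ k, 0 ≤ A k) ∧ 1 ≤ β₃ ∧ ∀ β : ℝ, β₃ ≤ β → ∀ m p K' : ℕ,
      ∫ v, recordProfile L β (linkEmbed L v) * (1 + β * ‖linkEmbed L v‖ ^ 2) ^ m * (Real.sqrt β * ‖linkEmbed L v‖) ^ p ∂orthoTransverse L ≤
          A (m + p) * ∫ v in coreBox L β, recordProfile L β (linkEmbed L v) ∂orthoTransverse L ∧
        ∫ v in coreBox L β, recordProfile L β (linkEmbed L v) ∂orthoTransverse L ≤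
          ∫ v in coreBox L β, recordProfile L β (linkEmbed L v) * (1 + β * ‖linkEmbed L v‖ ^ 2) ^ K' ∂orthoTransverse L := by
  haveI := isFiniteMeasure_orthoTransverse L
  have hle := measurable_linkEmbed L
  obtain ⟨hΩm, hΩ01, -, -⟩ := recordProfile_fields L
  obtain ⟨K, β₁, hK, hβ₁1, hnum⟩ := recordProfile_reweighted_moment_le L hL
  obtain ⟨k₀, β₂, hk₀, hβ₂, hfloor⟩ := recordProfile_core_floor L
  set d : ℕ := Module.finrank ℝ ({e : Edge 3 L // ¬e.1 = 0} → Fin 3 → ℝ) with hd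
  set c : ℝ := min 1 ((2 - 2 * Real.cos (2 * Real.pi / L)) / 2) with hc
  have hc0 : 0 < c := lt_min one_pos (half_pos (gap_pos (L := L) hL))
  refine ⟨fun k => K * 1 * (5 * Real.exp 1 * 2 ^ k * 4 ^ d * k.factorial * d.factorial) * (c ^ (k + d))⁻¹ / k₀, max β₁ β₂,
    fun k => div_nonneg (by positivity) hk₀.le, le_max_of_le_left hβ₁1, fun β hβ m p K' => ⟨?_, ?_⟩⟩
  · have h1 := hnum β ((le_max_left _ _).trans hβ) m p
    have h2 := hfloor β ((le_max_right _ _).trans hβ)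
    have hvb : (volume {w : {e : Edge 3 L // ¬e.1 = 0} → Fin 3 → ℝ | balLevel L β (balExt L w) ≤ 1}).toReal ≤
        (∫ v in coreBox L β, recordProfile L β (linkEmbed L v) ∂orthoTransverse L) / k₀ := by rw [le_div_iff₀ hk₀, mul_comm]; exact h2
    calc _ ≤ K * 1 * (5 * Real.exp 1 * 2 ^ (m + p) * 4 ^ d * (m + p).factorial * d.factorial) * (c ^ ((m + p) + d))⁻¹ *
          (volume {w : {e : Edge 3 L // ¬e.1 = 0} → Fin 3 → ℝ | balLevel L β (balExt L w) ≤ 1}).toReal := h1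
      _ ≤ K * 1 * (5 * Real.exp 1 * 2 ^ (m + p) * 4 ^ d * (m + p).factorial * d.factorial) * (c ^ ((m + p) + d))⁻¹ *
          ((∫ v in coreBox L β, recordProfile L β (linkEmbed L v) ∂orthoTransverse L) / k₀) := mul_le_mul_of_nonneg_left hvb (by positivity)
      _ = K * 1 * (5 * Real.exp 1 * 2 ^ (m + p) * 4 ^ d * (m + p).factorial * d.factorial) * (c ^ ((m + p) + d))⁻¹ / k₀ *
          ∫ v in coreBox L β, recordProfile L β (linkEmbed L v) ∂orthoTransverse L := by ring
  · have hβ1 : 1 ≤ β := hβ₁1.trans ((le_max_left _ _).trans hβ)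
    have hI1 : Integrable (fun v : Edge 3 L → Fin 3 → ℝ => recordProfile L β (linkEmbed L v)) (orthoTransverse L) :=
      integrable_of_measurable_abs_le _ ((hΩm β).comp hle) (C := 1) fun v => by
        show |recordProfile L β (linkEmbed L v)| ≤ 1
        rw [abs_of_nonneg (hΩ01 β _).1]; exact (hΩ01 β _).2
    have hI2 : Integrable (fun v : Edge 3 L → Fin 3 → ℝ => recordProfile L β (linkEmbed L v) * (1 + β * ‖linkEmbed L v‖ ^ 2) ^ K') (orthoTransverse L) := by
      refine integrable_of_measurable_abs_le _ (((hΩm β).comp hle).mul ((measurable_const.add ((hle.norm.pow_const 2).const_mul β)).pow_const K'))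
        (C := 1 * (1 + β * (min (1 / 40) (powScale (1 / 2) β * btLog β)) ^ 2) ^ K') fun v => ?_
      show |recordProfile L β (linkEmbed L v) * (1 + β * ‖linkEmbed L v‖ ^ 2) ^ K'| ≤ _
      rw [abs_mul, abs_of_nonneg (hΩ01 β _).1, abs_of_nonneg (by positivity : (0 : ℝ) ≤ (1 + β * ‖linkEmbed L v‖ ^ 2) ^ K')]
      by_cases hv : recordProfile L β (linkEmbed L v) = 0
      · rw [hv, zero_mul]; positivity
      · have hr := (recordProfile_support L hv).2.2
        exact mul_le_mul (hΩ01 β _).2 (pow_le_pow_left₀ (by positivity)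
          (by nlinarith [mul_le_mul_of_nonneg_left (pow_le_pow_left₀ (norm_nonneg _) hr 2) (by linarith : (0 : ℝ) ≤ β)]) K') (by positivity) zero_le_one
    refine setIntegral_mono_on hI1.integrableOn hI2.integrableOn (measurableSet_coreBox L β) fun v _ => ?_
    exact le_mul_of_one_le_right (hΩ01 β _).1 (one_le_pow₀ (by nlinarith [sq_nonneg ‖linkEmbed L v‖]))

end Summit.QuantumFields.YangMills.Theorems.FemtoTransferGap.RateTube

end
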